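import Mathlib

/-!
# HarmonicCeiling — idea-2 gen 9, card O12 "bound-harmonic ceiling" (statement skeleton)

HONEST FRAMING: low prior, high value-of-information experiment on Tao's machine
paradigm; NOT a claim that NS blows up.

Pure bookkeeping behind PREREG-NEG-R3P1-G9 (no PDE):  if the level-two band sup `U₂`
is SLAVED to the level-one band sup `U₁` with ratio ceiling `R` on the level-two horizon
(`U₂ t ≤ R * U₁ t`), then the level-two Reynolds ratio `r₂ = U₂(t₂) / (λ U₁,pk)` is at most
`R / λ`; with the printed sawtooth ceiling `R ≤ 1/2` and `λ = 2` this is `r₂ ≤ 1/4 < 1`, so a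
consecutive-level floor pass (`r₂ ≥ 1`, RULING R35 K-R3-1) forces the ratio to reach `λ`
somewhere ("level two must detach").  `peak_bracket` is the ordering statement P81(a):
a product of a hump peaking at `t₁` and a hump peaking at `tR ≤ t₁` is maximised on `[tR, t₁]`.
The numeric lemmas certify the registered instances (row (a) L128: R_max 0.413, r₂ 0.192).
Mathlib only; intended home (if the cell's Lean seats adopt it):
`Summits/NavierStokesRegularity/FluidComputer/HarmonicCeiling.lean`.  Staged by planner seat
pub-fluidc-idea-2 gen 9 (HOME/pub-fluidc-idea-2/SKETCH-R3-harmonic-ceiling.lean, sha16 c4d297f938d89169);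
filed verbatim by pub-fluidc-lit gen 38 (LEAN ASK #6).
-/

namespace Summit.NavierStokesRegularity.FluidComputer.HarmonicCeiling

/-- P80 algebra: a slaved level two has `r₂ ≤ R/λ`. -/
theorem slaved_r2_le {U₁ U₂ : ℝ → ℝ} {H : Set ℝ} {R lam U₁pk t₂ : ℝ}
    (hlam : 0 < lam) (hpk : 0 < U₁pk) (hR : 0 ≤ R)
    (hslave : ∀ t ∈ H, U₂ t ≤ R * U₁ t) (hcap : ∀ t ∈ H, U₁ t ≤ U₁pk) (ht₂ : t₂ ∈ H) :
    U₂ t₂ / (lam * U₁pk) ≤ R / lam := by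
  have h1 : U₂ t₂ ≤ R * U₁pk :=
    (hslave t₂ ht₂).trans (mul_le_mul_of_nonneg_left (hcap t₂ ht₂) hR)
  rw [div_le_div_iff₀ (mul_pos hlam hpk) hlam]
  nlinarith [h1, hlam, hpk]

/-- Consequence: with a ratio ceiling `R < λ` the level-two step cannot pass the floor. -/
theorem no_consecutive_pass_of_ceiling {U₁ U₂ : ℝ → ℝ} {H : Set ℝ} {R lam U₁pk t₂ : ℝ}
    (hlam : 0 < lam) (hpk : 0 < U₁pk) (hR : 0 ≤ R) (hRlam : R < lam)
    (hslave : ∀ t ∈ H, U₂ t ≤ R * U₁ t) (hcap : ∀ t ∈ H, U₁ t ≤ U₁pk) (ht₂ : t₂ ∈ H) :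
    U₂ t₂ / (lam * U₁pk) < 1 := by
  have h := slaved_r2_le hlam hpk hR hslave hcap ht₂
  have : R / lam < 1 := by rw [div_lt_iff₀ hlam, one_mul]; exact hRlam
  linarith

/-- Contrapositive ("detachment is necessary"): a level-two floor pass `r₂ ≥ 1` read at a
time `t₂` where level one is below its peak forces the instantaneous ratio to reach `λ`. -/
theorem ratio_ge_lam_of_pass {U₁ U₂ : ℝ → ℝ} {lam U₁pk t₂ : ℝ}
    (hlam : 0 < lam) (hpk : 0 < U₁pk) (hpos : 0 < U₁ t₂) (hcap : U₁ t₂ ≤ U₁pk)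
    (hpass : 1 ≤ U₂ t₂ / (lam * U₁pk)) :
    lam ≤ U₂ t₂ / U₁ t₂ := by
  have h1 : lam * U₁pk ≤ U₂ t₂ := by
    rwa [le_div_iff₀ (mul_pos hlam hpk), one_mul] at hpass
  rw [le_div_iff₀ hpos]
  nlinarith [h1, hcap, hlam]

/-- P81(a) bracket: `f` (level one) rises on `[a,t₁]` and falls on `[t₁,b]`; the ratio `g`
rises on `[a,tR]` and falls on `[tR,b]`, `tR ≤ t₁`; both nonnegative.  Then the product
`f*g` (level two) is dominated by its values on `[tR, t₁]`: level two peaks between the peak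
of the ratio and the peak of the carrier. -/
theorem peak_bracket {f g : ℝ → ℝ} {a tR t₁ b : ℝ}
    (haR : a ≤ tR) (hR1 : tR ≤ t₁) (h1b : t₁ ≤ b)
    (hf0 : ∀ t, 0 ≤ f t) (hg0 : ∀ t, 0 ≤ g t)
    (hf_up : MonotoneOn f (Set.Icc a t₁)) (hf_dn : AntitoneOn f (Set.Icc t₁ b))
    (hg_up : MonotoneOn g (Set.Icc a tR)) (hg_dn : AntitoneOn g (Set.Icc tR b)) :
    ∀ t ∈ Set.Icc a b, ∃ s ∈ Set.Icc tR t₁, f t * g t ≤ f s * g s := by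
  intro t ht
  obtain ⟨hat, htb⟩ := ht
  rcases le_or_gt t tR with h₁ | h₁
  · refine ⟨tR, ⟨le_rfl, hR1⟩, ?_⟩
    have hf : f t ≤ f tR := hf_up ⟨hat, h₁.trans hR1⟩ ⟨haR, hR1⟩ h₁
    have hg : g t ≤ g tR := hg_up ⟨hat, h₁⟩ ⟨haR, le_rfl⟩ h₁
    exact mul_le_mul hf hg (hg0 t) (hf0 tR)
  · rcases le_or_gt t t₁ with h₂ | h₂
    · exact ⟨t, ⟨h₁.le, h₂⟩, le_rfl⟩
    · refine ⟨t₁, ⟨hR1, le_rfl⟩, ?_⟩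
      have hf : f t ≤ f t₁ := hf_dn ⟨le_rfl, h1b⟩ ⟨h₂.le, htb⟩ h₂.le
      have hg : g t ≤ g t₁ := hg_dn ⟨hR1, h1b⟩ ⟨hR1.trans h₂.le, htb⟩ h₂.le
      exact mul_le_mul hf hg (hg0 t) (hf0 t₁)

/-- P82 discriminator in its simplest form: if the ratio is already at least `c·τ` for
`τ ≤ τ₀` (Fubini's `σ/2` law has `c = 1/2` per unit of the event clock) then it reaches the
level `ρ` no later than `τ = ρ / c`. -/
theorem ratio_half_time_le {Rf : ℝ → ℝ} {c ρ τ₀ : ℝ} (hc : 0 < c) (hρ : 0 ≤ ρ)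
    (hlin : ∀ τ, 0 ≤ τ → τ ≤ τ₀ → c * τ ≤ Rf τ) (hfit : ρ / c ≤ τ₀) :
    ρ ≤ Rf (ρ / c) := by
  have h := hlin (ρ / c) (div_nonneg hρ hc.le) hfit
  rwa [mul_div_cancel₀ _ hc.ne'] at h

/-! ## Registered numeric instances (PREREG-NEG-R3P1-G9; row (a) L128 reading) -/

/-- Sawtooth ceiling `1/2` at `λ = 2` gives `r₂ ≤ 1/4`, below the floor `1` and below the
registered bound `0.25`; the Fubini pre-shock ratio `0.3528/0.8801` lies in `(0.40, 0.401)`. -/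
theorem ceiling_numbers :
    (1 / 2 : ℝ) / 2 ≤ 0.25 ∧ (0.25 : ℝ) < 1 ∧
    (0.40 : ℝ) < 0.3528 / 0.8801 ∧ (0.3528 : ℝ) / 0.8801 < 0.401 := by
  norm_num

/-- Row (a) L128 (out2i): `R_max(W) = 0.413` ⇒ bound `0.413/2 = 0.2065 ≤ 0.25`, and the
deposited `r₂ = 0.192` sits under it; a pass would need the ratio to reach `2 > 0.79 > 0.5`. -/
theorem rowA_L128_numbers :
    (0.413 : ℝ) / 2 ≤ 0.25 ∧ (0.192 : ℝ) ≤ 0.413 / 2 ∧ (0.5 : ℝ) < 0.79 ∧ (0.79 : ℝ) < 2 := by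
  norm_num

end Summit.NavierStokesRegularity.FluidComputer.HarmonicCeiling
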